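import Literature.NumberTheory.Automorphic.MeyerRatMellin
import Literature.NumberTheory.Automorphic.MeyerLogPrimitive
import Mathlib.Analysis.Calculus.IteratedDeriv.Lemmas
import HarnessLib

/-!
# Meyer's global difference representation — proofs, `K = ℚ`: the logarithmic primitive on `H₋`

Topic `NumberTheory/Automorphic`; namespace `Literature.NumberTheory.Automorphic.Meyer`. Sibling
PROOF file for Step D of the plan for `Meyer.spectralRealisation_rat` [Meyer2005, Thm. 5.11]. It
glues the real-variable theory of `MeyerLogPrimitive` (super-exponentially decaying functions,
`R_s`) to Meyer's space `H₋ = 𝒮(C_ℚ)_∪` of `MeyerDifferenceRepresentation`: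

* `isSuperExp_iff_transfer` — `IsSuperExp φ` is EXACTLY the right-hand side of the transfer theorem
  `mem_Hminus_iff_of_unramified` (Leibniz rule for `φ · e^{α y}`); hence
  **`mem_Hminus_iff_isSuperExp`**: an unramified `f` lies in `H₋` iff `y ↦ f[z(e^y)]` is
  super-exponentially decaying [Meyer2005, §4.1, Lemma 5.10];
* `ofLog φ` — the unramified function `x ↦ φ(log |x|)` on `C_ℚ`; `mellin_ofLog` — its Mellin transform
  is `𝓛φ`;
* **`classLogPrimitive s f = ofLog (R_s (f ∘ z ∘ exp))`** — for an unramified `f ∈ H₋` whose Mellin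
  transform vanishes at `s` this is again an unramified element of `H₋`
  (`classLogPrimitive_mem_Hminus`) with `(z - s) · 𝓜(classLogPrimitive s f) = 𝓜f`
  (`mellin_classLogPrimitive`): the division of the Fourier–Laplace transform by `z - s` inside
  `𝒮(C_ℚ)_ℝ` used to build Jordan chains for `|x|^s` in `π₋` [Meyer2005, Thm. 5.11];
* `eq_of_mellin_eqOn` — two unramified elements of `H₋` whose (entire) Mellin transforms agree on
  the half-plane `Re z > 1` are equal (identity theorem + `eq_zero_of_mellin_eq_zero`).

Everything is proved; the definitions are `ofLog` and `classLogPrimitive`.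

## References

* R. Meyer, *On a representation of the idele class group related to primes and zeros of
  L-functions*, Duke Math. J. 127 (2005) = arXiv:math/0311468, §2.3, §4.1, Lemma 5.10, Thm. 5.11
  [Meyer2005].
-/

noncomputable section

open MeasureTheory Set Filter Complex NumberField
open scoped Topology ContDiff

namespace Literature.NumberTheory.Automorphic.Meyer

/-! ### Leibniz bounds and the transfer format -/

section Transfer

/-- Iterated derivatives of `y ↦ e^{cy}`. [folklore] -/
theorem iteratedDeriv_cexp_const_mul (c : ℂ) (k : ℕ) :
    iteratedDeriv k (fun y : ℝ => cexp (c * y)) = fun y : ℝ => c ^ k * cexp (c * y) := by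
  induction k with
  | zero => funext y; simp
  | succ k ih =>
      rw [iteratedDeriv_succ, ih]
      funext y
      have h : HasDerivAt (fun y : ℝ => c ^ k * cexp (c * y)) (c ^ k * (cexp (c * y) * c)) y := by
        have h1 : HasDerivAt (fun y : ℝ => c * (y : ℂ)) (c * 1) y := ((hasDerivAt_id' (y : ℂ)).const_mul c).comp_ofReal
        exact (h1.cexp.const_mul (c ^ k)).congr_deriv (by ring)
      rw [h.deriv]
      ring

/-- `y ↦ e^{cy}` is smooth. [folklore] -/
theorem contDiff_cexp_const_mul (c : ℂ) : ContDiff ℝ ∞ fun y : ℝ => cexp (c * y) :=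
  Complex.contDiff_exp.comp (contDiff_const.mul Complex.ofRealCLM.contDiff)

/-- **Leibniz bound**: `‖(u · e^{a·})⁽ⁿ⁾(y)‖ ≤ ∑_{i ≤ n} C(n,i) |a|^{n-i} ‖u⁽ⁱ⁾(y)‖ e^{ay}`. [folklore] -/
theorem norm_iteratedDeriv_mul_cexp_le {u : ℝ → ℂ} (hu : ContDiff ℝ ∞ u) (a : ℝ) (n : ℕ) (y : ℝ) :
    ‖iteratedDeriv n (fun y : ℝ => u y * cexp (a * y)) y‖ ≤
      ∑ i ∈ Finset.range (n + 1), (n.choose i : ℝ) * |a| ^ (n - i) * ‖iteratedDeriv i u y‖ * Real.exp (a * y) := by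
  have hE := contDiff_cexp_const_mul (a : ℂ)
  have hprod : (fun y : ℝ => u y * cexp (a * y)) = u * fun y : ℝ => cexp ((a : ℂ) * y) := rfl
  rw [hprod, iteratedDeriv_mul ((hu.of_le (mod_cast le_top)).contDiffAt) ((hE.of_le (mod_cast le_top)).contDiffAt)]
  refine (norm_sum_le _ _).trans (Finset.sum_le_sum fun i _ => ?_)
  rw [iteratedDeriv_cexp_const_mul, norm_mul, norm_mul, norm_mul, Complex.norm_natCast, norm_pow,
    Complex.norm_real, Real.norm_eq_abs, Complex.norm_exp]
  have hre : ((a : ℂ) * (y : ℂ)).re = a * y := by simp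
  rw [hre]
  ring_nf
  rfl

/-- Real and complex exponential weights agree. [folklore] -/
theorem mul_ofReal_exp_eq (u : ℝ → ℂ) (a : ℝ) :
    (fun y : ℝ => u y * (Real.exp (a * y) : ℂ)) = fun y : ℝ => u y * cexp (a * y) := by
  funext y
  rw [Complex.ofReal_exp, Complex.ofReal_mul]

/-- **`IsSuperExp` is the transfer format of `mem_Hminus_iff_of_unramified`.**
[cite: Meyer2005, §4.1] -/
theorem isSuperExp_iff_transfer (φ : ℝ → ℂ) :
    IsSuperExp φ ↔ ∀ α : ℝ,
      ContDiff ℝ ∞ (fun y : ℝ => φ y * (Real.exp (α * y) : ℂ)) ∧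
        ∀ n β : ℕ, ∃ C : ℝ, ∀ y : ℝ,
          (1 + |y|) ^ β * ‖iteratedFDeriv ℝ n (fun y : ℝ => φ y * (Real.exp (α * y) : ℂ)) y‖ ≤ C := by
  constructor
  · intro hφ α
    rw [mul_ofReal_exp_eq]
    refine ⟨hφ.contDiff.mul (contDiff_cexp_const_mul _), fun n β => ?_⟩
    choose C hC using fun i => hφ.decay i β α
    refine ⟨∑ i ∈ Finset.range (n + 1), (n.choose i : ℝ) * |α| ^ (n - i) * C i, fun y => ?_⟩
    rw [norm_iteratedFDeriv_eq_norm_iteratedDeriv]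
    have hw : 0 ≤ (1 + |y|) ^ β := by positivity
    calc (1 + |y|) ^ β * ‖iteratedDeriv n (fun y : ℝ => φ y * cexp (α * y)) y‖
        ≤ (1 + |y|) ^ β * ∑ i ∈ Finset.range (n + 1),
            (n.choose i : ℝ) * |α| ^ (n - i) * ‖iteratedDeriv i φ y‖ * Real.exp (α * y) := by
          gcongr
          exact norm_iteratedDeriv_mul_cexp_le hφ.contDiff α n y
      _ = ∑ i ∈ Finset.range (n + 1), (n.choose i : ℝ) * |α| ^ (n - i) *
            ((1 + |y|) ^ β * (‖iteratedDeriv i φ y‖ * Real.exp (α * y))) := by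
          rw [Finset.mul_sum]
          refine Finset.sum_congr rfl fun i _ => ?_
          ring
      _ ≤ ∑ i ∈ Finset.range (n + 1), (n.choose i : ℝ) * |α| ^ (n - i) * C i := by
          gcongr with i hi
          exact hC i y
  · intro h
    have hsmooth : ContDiff ℝ ∞ φ := by
      have h0 := (h 0).1
      have : (fun y : ℝ => φ y * (Real.exp (0 * y) : ℂ)) = φ := by
        funext y; rw [zero_mul, Real.exp_zero, Complex.ofReal_one, mul_one]
      rwa [this] at h0
    refine ⟨hsmooth, fun n β α => ?_⟩
    -- `φ = (φ e^{α·}) · e^{-α·}`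
    set F : ℝ → ℂ := fun y : ℝ => φ y * cexp (α * y) with hF
    have hFsmooth : ContDiff ℝ ∞ F := hsmooth.mul (contDiff_cexp_const_mul _)
    have hφF : φ = fun y : ℝ => F y * cexp ((-α : ℝ) * y) := by
      funext y
      rw [hF]
      simp only
      rw [mul_assoc, ← Complex.exp_add]
      push_cast
      rw [show (α : ℂ) * y + -(α : ℂ) * y = 0 by ring, Complex.exp_zero, mul_one]
    choose C hC using fun i => (h α).2 i β
    refine ⟨∑ i ∈ Finset.range (n + 1), (n.choose i : ℝ) * |(-α)| ^ (n - i) * C i, fun y => ?_⟩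
    have hw : 0 ≤ (1 + |y|) ^ β := by positivity
    have hb := norm_iteratedDeriv_mul_cexp_le hFsmooth (-α) n y
    rw [← hφF] at hb
    calc (1 + |y|) ^ β * (‖iteratedDeriv n φ y‖ * Real.exp (α * y))
        ≤ (1 + |y|) ^ β * ((∑ i ∈ Finset.range (n + 1),
            (n.choose i : ℝ) * |(-α)| ^ (n - i) * ‖iteratedDeriv i F y‖ * Real.exp (-α * y)) * Real.exp (α * y)) := by
          gcongr
      _ = ∑ i ∈ Finset.range (n + 1), (n.choose i : ℝ) * |(-α)| ^ (n - i) *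
            ((1 + |y|) ^ β * ‖iteratedDeriv i F y‖) := by
          rw [Finset.sum_mul, Finset.mul_sum]
          refine Finset.sum_congr rfl fun i _ => ?_
          have : Real.exp (-α * y) * Real.exp (α * y) = 1 := by
            rw [← Real.exp_add, show -α * y + α * y = 0 by ring, Real.exp_zero]
          calc (1 + |y|) ^ β * ((n.choose i : ℝ) * |(-α)| ^ (n - i) * ‖iteratedDeriv i F y‖ * Real.exp (-α * y) *
                Real.exp (α * y))
              = (n.choose i : ℝ) * |(-α)| ^ (n - i) * ((1 + |y|) ^ β * ‖iteratedDeriv i F y‖) *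
                  (Real.exp (-α * y) * Real.exp (α * y)) := by ring
            _ = _ := by rw [this, mul_one]
      _ ≤ ∑ i ∈ Finset.range (n + 1), (n.choose i : ℝ) * |(-α)| ^ (n - i) * C i := by
          gcongr with i hi
          have h' := hC i y
          rw [mul_ofReal_exp_eq, norm_iteratedFDeriv_eq_norm_iteratedDeriv] at h'
          exact h'

variable {f : IdeleClassGroup ℚ → ℂ}

/-- **An unramified `f` lies in `H₋` iff `y ↦ f[z(e^y)]` is super-exponentially decaying.**
[cite: Meyer2005, §4.1] -/
theorem mem_Hminus_iff_isSuperExp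
    (hunr : ∀ u ∈ integralFiniteUnits ℚ, ∀ x, f (x * finiteUnitClass ℚ u) = f x) :
    f ∈ Hminus ℚ ↔ IsSuperExp (fun y : ℝ => f (posClass y)) :=
  (mem_Hminus_iff_of_unramified hunr).trans (isSuperExp_iff_transfer _).symm

end Transfer

/-! ### Unramified functions from functions of `log |x|` -/

section OfLog

/-- **The unramified function `x ↦ φ(log |x|)` on `C_ℚ`.** [cite: Meyer2005, §1 p. 3] -/
def ofLog (φ : ℝ → ℂ) : IdeleClassGroup ℚ → ℂ :=
  fun x => φ (Real.log (classNorm ℚ x))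

/-- `ofLog φ [z(e^y)] = φ(y)`. [folklore] -/
@[simp]
theorem ofLog_posClass (φ : ℝ → ℂ) (y : ℝ) : ofLog φ (posClass y) = φ y := by
  rw [ofLog, log_classNorm_posClass]

/-- `ofLog φ` is `𝒪̂ˣ`-invariant. [folklore] -/
theorem ofLog_unramified (φ : ℝ → ℂ) :
    ∀ u ∈ integralFiniteUnits ℚ, ∀ x, ofLog φ (x * finiteUnitClass ℚ u) = ofLog φ x := by
  intro u hu x
  simp only [ofLog, classNorm_mul, classNorm_finiteUnitClass hu, mul_one]

/-- The logarithmic picture of `ofLog φ` is `φ`. [folklore] -/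
theorem ofLog_comp_posClass (φ : ℝ → ℂ) : (fun y : ℝ => ofLog φ (posClass y)) = φ :=
  funext (ofLog_posClass φ)

/-- An unramified `f` is `ofLog` of its logarithmic picture. [cite: Meyer2005, §1 p. 3] -/
theorem ofLog_apply_posClass_eq {f : IdeleClassGroup ℚ → ℂ}
    (hunr : ∀ u ∈ integralFiniteUnits ℚ, ∀ x, f (x * finiteUnitClass ℚ u) = f x) :
    ofLog (fun y : ℝ => f (posClass y)) = f := by
  funext x
  rw [ofLog, ← apply_eq_apply_posClass_log hunr x]

/-- `ofLog φ ∈ H₋` iff `φ` is super-exponentially decaying. [cite: Meyer2005, §4.1] -/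
theorem ofLog_mem_Hminus_iff (φ : ℝ → ℂ) : ofLog φ ∈ Hminus ℚ ↔ IsSuperExp φ := by
  rw [mem_Hminus_iff_isSuperExp (ofLog_unramified φ), ofLog_comp_posClass]

/-- **The Mellin transform of `ofLog φ` is the Laplace transform of `φ`.** [cite: Meyer2005, §2.3] -/
theorem mellin_ofLog (φ : ℝ → ℂ) (z : ℂ) :
    mellin (fun t : ℝ => ofLog φ (posClass (Real.log t))) z = laplace φ z := by
  simp only [ofLog_posClass]
  exact mellin_comp_log φ z

/-- The Mellin transform of an unramified `f` in terms of its logarithmic picture.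
[cite: Meyer2005, §2.3] -/
theorem mellin_eq_laplace (f : IdeleClassGroup ℚ → ℂ) (z : ℂ) :
    mellin (fun t : ℝ => f (posClass (Real.log t))) z = laplace (fun y : ℝ => f (posClass y)) z :=
  mellin_comp_log (fun y : ℝ => f (posClass y)) z

end OfLog

/-! ### The identity theorem for Mellin transforms of unramified vectors of `H₋` -/

section Identity

variable {f g : IdeleClassGroup ℚ → ℂ}

/-- An entire function vanishing on the half-plane `Re z > 1` vanishes identically. [folklore] -/
theorem eq_zero_of_differentiable_of_eqOn {F : ℂ → ℂ} (hF : Differentiable ℂ F)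
    (h : ∀ z : ℂ, 1 < z.re → F z = 0) (z : ℂ) : F z = 0 := by
  have hana : AnalyticOnNhd ℂ F univ := (hF.differentiableOn.analyticOnNhd isOpen_univ)
  have hev : F =ᶠ[𝓝 (2 : ℂ)] 0 := by
    have hopen : IsOpen {z : ℂ | 1 < z.re} := isOpen_lt continuous_const Complex.continuous_re
    filter_upwards [hopen.mem_nhds (show (2 : ℂ) ∈ {z : ℂ | 1 < z.re} by simp)] with w hw
    exact h w hw
  have := hana.eqOn_zero_of_preconnected_of_eventuallyEq_zero isPreconnected_univ (mem_univ 2) hev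
  exact this (mem_univ z)

/-- **Unramified elements of `H₋` with the same Mellin transform on `Re z > 1` are equal.**
[cite: Meyer2005, Lemma 5.10] -/
theorem eq_of_mellin_eqOn
    (hfu : ∀ u ∈ integralFiniteUnits ℚ, ∀ x, f (x * finiteUnitClass ℚ u) = f x) (hf : f ∈ Hminus ℚ)
    (hgu : ∀ u ∈ integralFiniteUnits ℚ, ∀ x, g (x * finiteUnitClass ℚ u) = g x) (hg : g ∈ Hminus ℚ)
    (h : ∀ z : ℂ, 1 < z.re →
      mellin (fun t : ℝ => f (posClass (Real.log t))) z = mellin (fun t : ℝ => g (posClass (Real.log t))) z) :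
    f = g := by
  have hdu : ∀ u ∈ integralFiniteUnits ℚ, ∀ x, (f - g) (x * finiteUnitClass ℚ u) = (f - g) x := by
    intro u hu x
    simp only [Pi.sub_apply, hfu u hu x, hgu u hu x]
  have hd : f - g ∈ Hminus ℚ := Submodule.sub_mem _ hf hg
  have hF : Differentiable ℂ (mellin (fun t : ℝ => (f - g) (posClass (Real.log t)))) :=
    differentiable_mellin_of_mem_Hminus hdu hd
  have hzero : ∀ z : ℂ, 1 < z.re → mellin (fun t : ℝ => (f - g) (posClass (Real.log t))) z = 0 := by
    intro z hz
    rw [mellin_sub_of_mem_Hminus hfu hf hgu hg z, h z hz, sub_self]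
  have hall := eq_zero_of_differentiable_of_eqOn hF hzero
  have := eq_zero_of_mellin_eq_zero hdu hd fun τ => hall _
  exact sub_eq_zero.mp this

end Identity

/-! ### The logarithmic primitive on `H₋` -/

section ClassLogPrimitive

variable {f : IdeleClassGroup ℚ → ℂ} (s : ℂ)

/-- **`R_s` on unramified functions on `C_ℚ`**: `classLogPrimitive s f = ofLog (R_s (y ↦ f[z(e^y)]))`.
[cite: Meyer2005, Thm. 5.11] -/
def classLogPrimitive (s : ℂ) (f : IdeleClassGroup ℚ → ℂ) : IdeleClassGroup ℚ → ℂ :=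
  ofLog (logPrimitive s (fun y : ℝ => f (posClass y)))

/-- `classLogPrimitive s f` is unramified. [folklore] -/
theorem classLogPrimitive_unramified (f : IdeleClassGroup ℚ → ℂ) :
    ∀ u ∈ integralFiniteUnits ℚ, ∀ x,
      classLogPrimitive s f (x * finiteUnitClass ℚ u) = classLogPrimitive s f x :=
  ofLog_unramified _

/-- The logarithmic picture of `classLogPrimitive s f`. [folklore] -/
theorem classLogPrimitive_posClass (f : IdeleClassGroup ℚ → ℂ) (y : ℝ) :
    classLogPrimitive s f (posClass y) = logPrimitive s (fun y : ℝ => f (posClass y)) y :=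
  ofLog_posClass _ y

/-- The vanishing hypothesis: `𝓜f(s) = 0` iff `𝓛(f ∘ z ∘ exp)(s) = 0`. [folklore] -/
theorem laplace_eq_zero_of_mellin_eq_zero (h0 : mellin (fun t : ℝ => f (posClass (Real.log t))) s = 0) :
    laplace (fun y : ℝ => f (posClass y)) s = 0 := by
  rwa [mellin_eq_laplace] at h0

/-- **`classLogPrimitive s f ∈ H₋`** for an unramified `f ∈ H₋` with `𝓜f(s) = 0`.
[cite: Meyer2005, Thm. 5.11] -/
theorem classLogPrimitive_mem_Hminus
    (hunr : ∀ u ∈ integralFiniteUnits ℚ, ∀ x, f (x * finiteUnitClass ℚ u) = f x) (hf : f ∈ Hminus ℚ)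
    (h0 : mellin (fun t : ℝ => f (posClass (Real.log t))) s = 0) :
    classLogPrimitive s f ∈ Hminus ℚ := by
  rw [classLogPrimitive, ofLog_mem_Hminus_iff]
  exact isSuperExp_logPrimitive s ((mem_Hminus_iff_isSuperExp hunr).mp hf)
    (laplace_eq_zero_of_mellin_eq_zero s h0)

/-- **`(z - s) 𝓜(classLogPrimitive s f)(z) = 𝓜f(z)`.** [cite: Meyer2005, Thm. 5.11] -/
theorem mellin_classLogPrimitive
    (hunr : ∀ u ∈ integralFiniteUnits ℚ, ∀ x, f (x * finiteUnitClass ℚ u) = f x) (hf : f ∈ Hminus ℚ)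
    (h0 : mellin (fun t : ℝ => f (posClass (Real.log t))) s = 0) (z : ℂ) :
    (z - s) * mellin (fun t : ℝ => classLogPrimitive s f (posClass (Real.log t))) z =
      mellin (fun t : ℝ => f (posClass (Real.log t))) z := by
  rw [classLogPrimitive, mellin_ofLog, mellin_eq_laplace]
  exact laplace_logPrimitive s ((mem_Hminus_iff_isSuperExp hunr).mp hf) (laplace_eq_zero_of_mellin_eq_zero s h0) z

/-- The explicit relation `f = -(R_s f)' - s R_s f` in the logarithmic picture, i.e.
`f[z(e^y)] = -(d/dy)(classLogPrimitive s f [z(e^y)]) - s · classLogPrimitive s f [z(e^y)]`.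
[cite: Meyer2005, Thm. 5.11] -/
theorem apply_posClass_eq_deriv_classLogPrimitive
    (hunr : ∀ u ∈ integralFiniteUnits ℚ, ∀ x, f (x * finiteUnitClass ℚ u) = f x) (hf : f ∈ Hminus ℚ) (y : ℝ) :
    f (posClass y) = -deriv (fun y : ℝ => classLogPrimitive s f (posClass y)) y
      - s * classLogPrimitive s f (posClass y) := by
  have hφ := (mem_Hminus_iff_isSuperExp hunr).mp hf
  simp only [classLogPrimitive_posClass]
  rw [show (fun y : ℝ => logPrimitive s (fun y : ℝ => f (posClass y)) y) = logPrimitive s (fun y : ℝ => f (posClass y))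
    from rfl, deriv_logPrimitive s hφ]
  ring

end ClassLogPrimitive

end Literature.NumberTheory.Automorphic.Meyer
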